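import Literature.AnabelianGeometry.SemiGraphs.TemperedAnabelian
import Mathlib.Topology.Algebra.Group.ClosedSubgroup

/-!
# Homomorphisms of DOF-type compose ([SemiAnbd] §6, Def. 6.2; used on pp. 73–74)

Mochizuki, *Semi-graphs of anabelioids*, Publ. RIMS **42** (2006) [SemiAnbd], §6, Definition 6.2
(ii)/(iii), p. 70: a subgroup of a topological group is *of DOF-type* if it is dense in some open
subgroup of finite index; a continuous homomorphism is of DOF-type if its image is.  On pp. 73–74
the category `DLoc_{G_K}(Π^temp_{X_K})` of dominant localizations is defined with MORPHISMS "outer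
homomorphism[s] of DOF-type" — so DOF-type homomorphisms must be closed under composition and
contain the identities for this to be a category.  The paper uses this without comment; this
proof-only file supplies it over the tree's `IsDOFType` / `IsDOFTypeHom`
(`SemiGraphs/TemperedAnabelian.lean`). [cite: MochizukiSemiAnbd2006, Def 6.2 p.70]

Contents (pure topological group theory, no anabelian input): `IsDOFType H` iff the closure `H⁻`
is an open subgroup of finite index (`isDOFType_iff_topologicalClosure`); DOF-type is upward closed;
surjections (in particular identities and isomorphisms) are of DOF-type; the image of an open
subgroup of finite index under a DOF-type homomorphism is of DOF-type
(`IsDOFTypeHom.isDOFType_map`: the closure of the image has finite index because the target is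
covered by finitely many of its cosets, and a closed subgroup of finite index is open); hence
composites of DOF-type homomorphisms are of DOF-type (`IsDOFTypeHom.comp`).  Cell abc-iut, layer
L3, seat abc-iut-L3-t4 (input for the morphisms of `DLoc_{G_K}(Π^temp_{X_K})`); nothing here takes
a side on any disputed claim.
-/

namespace Literature.AnabelianGeometry.SemiGraphs

open scoped Pointwise
open Topology

universe u v w

variable {F : Type u} [Group F] [TopologicalSpace F]
variable {F₂ : Type v} [Group F₂] [TopologicalSpace F₂]
variable {F₃ : Type w} [Group F₃] [TopologicalSpace F₃]

/-- A subgroup `H` is of DOF-type ([SemiAnbd] Def. 6.2 (ii): dense in some open subgroup of finite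
index) iff its closure `H⁻` — a subgroup — is open and of finite index.
[cite: MochizukiSemiAnbd2006, Def 6.2(ii) p.70] -/
theorem isDOFType_iff_topologicalClosure [IsTopologicalGroup F] (H : Subgroup F) :
    IsDOFType H ↔ IsOpen (H.topologicalClosure : Set F) ∧ H.topologicalClosure.FiniteIndex := by
  constructor
  · rintro ⟨U, hUo, hUf, hcl⟩
    have hU : H.topologicalClosure = U :=
      SetLike.coe_injective (by rw [Subgroup.topologicalClosure_coe]; exact hcl)
    rw [hU]
    exact ⟨hUo, hUf⟩
  · rintro ⟨ho, hf⟩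
    exact ⟨H.topologicalClosure, ho, hf, Subgroup.topologicalClosure_coe.symm⟩

/-- DOF-type is upward closed: a subgroup containing a subgroup of DOF-type is of DOF-type (its
closure contains an open subgroup of finite index).
[cite: MochizukiSemiAnbd2006, Def 6.2(ii) p.70] -/
theorem IsDOFType.of_le [IsTopologicalGroup F] {H H' : Subgroup F} (hH : IsDOFType H)
    (h : H ≤ H') : IsDOFType H' := by
  rw [isDOFType_iff_topologicalClosure] at hH ⊢
  have hle : H.topologicalClosure ≤ H'.topologicalClosure := Subgroup.topologicalClosure_mono h
  haveI := hH.2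
  exact ⟨Subgroup.isOpen_mono hle hH.1, Subgroup.finiteIndex_of_le hle⟩

/-- The whole group is a subgroup of DOF-type. [cite: MochizukiSemiAnbd2006, Def 6.2(ii) p.70] -/
theorem isDOFType_top : IsDOFType (⊤ : Subgroup F) :=
  ⟨⊤, by simp, inferInstance, by simp⟩

/-- A continuous surjective homomorphism is of DOF-type.
[cite: MochizukiSemiAnbd2006, Def 6.2(iii) p.70] -/
theorem isDOFTypeHom_of_surjective (φ : F →ₜ* F₂) (hφ : Function.Surjective φ) :
    IsDOFTypeHom φ := by
  unfold IsDOFTypeHom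
  rw [MonoidHom.range_eq_top_of_surjective φ.toMonoidHom hφ]
  exact isDOFType_top

/-- The identity is of DOF-type. [cite: MochizukiSemiAnbd2006, Def 6.2(iii) p.70] -/
theorem isDOFTypeHom_id : IsDOFTypeHom (ContinuousMonoidHom.id F) :=
  isDOFTypeHom_of_surjective _ fun x => ⟨x, rfl⟩

/-- An isomorphism of topological groups, viewed as a continuous homomorphism, is of DOF-type.
[cite: MochizukiSemiAnbd2006, Def 6.2(iii) p.70] -/
theorem isDOFTypeHom_of_continuousMulEquiv (e : F ≃ₜ* F₂) :
    IsDOFTypeHom (⟨e.toMulEquiv.toMonoidHom, e.continuous⟩ : F →ₜ* F₂) :=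
  isDOFTypeHom_of_surjective _ e.surjective

/-- **Key step.** If `ψ : F₂ → F₃` is of DOF-type and `U ⊆ F₂` is an open subgroup of finite index,
then `ψ(U)` is of DOF-type: its closure `V` is a closed subgroup of finite index (the closure `W` of
`ψ(F₂)` is open of finite index and is covered by the finitely many closed cosets `ψ(t)·V`, `t`
running over coset representatives of `U`), hence open.
[cite: MochizukiSemiAnbd2006, Def 6.2(iii) p.70] -/
theorem IsDOFTypeHom.isDOFType_map [IsTopologicalGroup F₃] {ψ : F₂ →ₜ* F₃}
    (hψ : IsDOFTypeHom ψ) (U : Subgroup F₂) [U.FiniteIndex] :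
    IsDOFType (U.map ψ.toMonoidHom) := by
  rw [isDOFType_iff_topologicalClosure]
  obtain ⟨-, hWf⟩ := (isDOFType_iff_topologicalClosure _).1 hψ
  set V := (U.map ψ.toMonoidHom).topologicalClosure with hV
  set W := ψ.toMonoidHom.range.topologicalClosure with hW
  -- Step 1: `W ⊆ ⋃_{q ∈ F₂/U} ψ(q.out) • V`.
  have hcov : (W : Set F₃) ⊆ ⋃ q : F₂ ⧸ U, ψ q.out • (V : Set F₃) := by
    have hclosed : IsClosed (⋃ q : F₂ ⧸ U, ψ q.out • (V : Set F₃)) :=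
      isClosed_iUnion_of_finite fun q => (Subgroup.isClosed_topologicalClosure _).smul _
    rw [hW, Subgroup.topologicalClosure_coe]
    refine closure_minimal ?_ hclosed
    rintro _ ⟨x, rfl⟩
    obtain ⟨u, hu⟩ := QuotientGroup.mk_out_eq_mul U x
    refine Set.mem_iUnion.2 ⟨QuotientGroup.mk x, ?_⟩
    refine Set.mem_smul_set.2 ⟨ψ ((u : F₂)⁻¹), ?_, ?_⟩
    · exact Subgroup.le_topologicalClosure _ ⟨(u : F₂)⁻¹, U.inv_mem u.2, rfl⟩
    · change ψ _ * ψ _ = ψ.toMonoidHom x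
      rw [← map_mul, hu, mul_inv_cancel_right]
      rfl
  -- Step 2: `V` has finite index: `(F₃/W) × (F₂/U) ↠ F₃/V`.
  haveI : W.FiniteIndex := hWf
  have hVf : V.FiniteIndex := by
    haveI : Finite (F₃ ⧸ V) := by
      refine Finite.of_surjective
        (fun a : (F₃ ⧸ W) × (F₂ ⧸ U) => (QuotientGroup.mk (a.1.out * ψ a.2.out) : F₃ ⧸ V))
        ?_
      intro z
      induction z using QuotientGroup.induction_on with
      | H z =>
        obtain ⟨w, hw⟩ := QuotientGroup.mk_out_eq_mul W z
        -- `w⁻¹ ∈ W ⊆ ⋃ ψ(q.out) • V`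
        have hw' : ((w : F₃)⁻¹) ∈ ⋃ q : F₂ ⧸ U, ψ q.out • (V : Set F₃) :=
          hcov (W.inv_mem w.2)
        obtain ⟨q, hq⟩ := Set.mem_iUnion.1 hw'
        obtain ⟨v, hv, hqv⟩ := Set.mem_smul_set.1 hq
        refine ⟨⟨QuotientGroup.mk z, q⟩, ?_⟩
        change (QuotientGroup.mk ((QuotientGroup.mk z : F₃ ⧸ W).out * ψ q.out) : F₃ ⧸ V) =
          QuotientGroup.mk z
        rw [QuotientGroup.eq, hw]
        have key : ((z * (w : F₃) * ψ q.out)⁻¹ * z : F₃) = v := by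
          rw [smul_eq_mul] at hqv
          rw [mul_inv_rev, mul_inv_rev, mul_assoc, mul_assoc, inv_mul_cancel, mul_one, ← hqv,
            inv_mul_cancel_left]
        rw [key]
        exact hv
    exact Subgroup.finiteIndex_of_finite_quotient
  haveI := hVf
  exact ⟨V.isOpen_of_isClosed_of_finiteIndex (Subgroup.isClosed_topologicalClosure _), hVf⟩

/-- **DOF-type homomorphisms compose** (needed for [SemiAnbd] pp. 73–74, where the morphisms of
`DLoc_{G_K}(Π^temp_{X_K})` are outer homomorphisms of DOF-type): if `φ : F₁ → F₂` and
`ψ : F₂ → F₃` are of DOF-type then so is `ψ ∘ φ` — the closure of `ψ(φ(F₁))` contains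
`ψ(φ(F₁)⁻)`, the image of an open subgroup of finite index, which is of DOF-type by
`IsDOFTypeHom.isDOFType_map`. [cite: MochizukiSemiAnbd2006, Def 6.2(iii) p.70] -/
theorem IsDOFTypeHom.comp [IsTopologicalGroup F₂] [IsTopologicalGroup F₃] {ψ : F₂ →ₜ* F₃}
    {φ : F →ₜ* F₂} (hψ : IsDOFTypeHom ψ)
    (hφ : IsDOFTypeHom φ) : IsDOFTypeHom (ψ.comp φ) := by
  obtain ⟨hUo, hUf⟩ := (isDOFType_iff_topologicalClosure _).1 hφ
  set U := φ.toMonoidHom.range.topologicalClosure with hU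
  haveI := hUf
  have hV := (isDOFType_iff_topologicalClosure _).1 (hψ.isDOFType_map U)
  unfold IsDOFTypeHom
  rw [isDOFType_iff_topologicalClosure]
  have hle : (U.map ψ.toMonoidHom).topologicalClosure ≤
      (ψ.comp φ).toMonoidHom.range.topologicalClosure := by
    refine Subgroup.topologicalClosure_minimal _ ?_ (Subgroup.isClosed_topologicalClosure _)
    rintro _ ⟨x, hx, rfl⟩
    have hx' : x ∈ closure ((φ.toMonoidHom.range : Subgroup F₂) : Set F₂) := by
      rw [← Subgroup.topologicalClosure_coe]; exact hx
    have himg : ψ x ∈ closure (ψ '' ((φ.toMonoidHom.range : Subgroup F₂) : Set F₂)) :=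
      image_closure_subset_closure_image ψ.continuous ⟨x, hx', rfl⟩
    have hrange : ψ '' ((φ.toMonoidHom.range : Subgroup F₂) : Set F₂) =
        (((ψ.comp φ).toMonoidHom.range : Subgroup F₃) : Set F₃) := by
      ext y
      constructor
      · rintro ⟨_, ⟨a, rfl⟩, rfl⟩; exact ⟨a, rfl⟩
      · rintro ⟨a, rfl⟩; exact ⟨φ a, ⟨a, rfl⟩, rfl⟩
    rw [hrange, ← Subgroup.topologicalClosure_coe] at himg
    exact himg
  haveI := hV.2
  exact ⟨Subgroup.isOpen_mono hle hV.1, Subgroup.finiteIndex_of_le hle⟩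

end Literature.AnabelianGeometry.SemiGraphs
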